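import Mathlib
import Summits.Ventures.PercRepro.TriangleCapFiveRowFourPieces

/-!
# PercRepro — THE ROW `a = 5` AT `r = 4` AT THE SHARP GAP `B2 = 2k − 22`, THE PIECES: the convexity of the window
`[5, k − 6]`, the sides of a `5`-bipartite `D − z`, and the deletion arithmetic at the target
`Σ_v d(v)² + 4 (k − 5) + (2k − 22) ≤ m k` (p3, gen 47; part 200b)

The pieces of part 199w read at the sharp target. The window `[5, k − 6]` (no vertex at the cap `k − 5`, every degree
`≥ 5`) gives `d² + 5 (k − 6) ≤ (k − 1) d` per vertex, hence `Σ_v d(v)² ≤ m k − 5 (k − 10) − 4 (k − 2)`, slack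
`3k − 16` to the target (`five_four_convex_B2`) — so the within-row deletion of a vertex of degree `5` is never
needed. A `5`-bipartite `D − z` with all neighbours of `z` off the side makes `D` `6`-bipartite with `k − 7`
missing pairs, whose bipartite closed form `m k − 6 (k − 7)` IS the target (`five_four_sides_B2`: this is the family
`B2`, `K_{6,k−6}` minus a `(k − 7)`-star, when `d(z) = 1`). The deletions of a vertex `z` of degree `d ≤ 4` onto
the landed cells `(k − 1, 5, d − 1)` (`d ≥ 1`; `(k − 1, 6, k − 13)` at `d = 0`) with the neighbours of `z` at
degree `≤ k − 7` in `D − z`: slack `10`, `16` / `0` (the envelope read of `d = 1`, exactly the family `B2`), `6` / `18`,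
`8` / `16`, `6` / `6` (mixed / non-`5`-bipartite). Axioms: standard.
-/

namespace PercRepro

namespace TriangleCap

namespace C047

open Finset

variable {V : Type*} [Fintype V] [DecidableEq V]

/-- The convexity term of the window `[5, k − 6]`: `5 ≤ d ≤ k − 6` ⇒ `d² + 5 (k − 6) ≤ (k − 1) d`. -/
theorem convex_vertex_five_six (d k : ℕ) (h5 : 5 ≤ d) (hd : d + 6 ≤ k) : d * d + 5 * (k - 6) ≤ (k - 1) * d := by
  obtain ⟨a, rfl⟩ : ∃ a, d = a + 5 := ⟨d - 5, by omega⟩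
  obtain ⟨b, rfl⟩ : ∃ b, k = a + 5 + 6 + b := ⟨k - (a + 5 + 6), by omega⟩
  have e1 : a + 5 + 6 + b - 6 = a + 5 + b := by omega
  have e2 : a + 5 + 6 + b - 1 = a + 10 + b := by omega
  rw [e1, e2]
  nlinarith

omit [DecidableEq V] in
/-- **THE CONVEXITY OF THE WINDOW `[5, k − 6]` ON `(k, 5, 4)`:** every degree in `[5, k − 6]` gives
`Σ_v d(v)² + 4 (k − 5) + (2k − 22) ≤ m k` (`k ≥ 14`; slack `3k − 16`). -/
theorem five_four_convex_B2 (D : SimpleGraph V) [DecidableRel D.Adj] (hk : 14 ≤ Fintype.card V)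
    (hm : D.edgeFinset.card + 4 = 5 * (Fintype.card V - 5)) (hcap : ∀ v, deg D v + 6 ≤ Fintype.card V)
    (hdeg : ∀ v, 5 ≤ deg D v) :
    ∑ v, deg D v * deg D v + 4 * (Fintype.card V - 5) + (2 * Fintype.card V - 22) ≤
      D.edgeFinset.card * Fintype.card V := by
  have h : ∀ v ∈ (univ : Finset V), deg D v * deg D v + 5 * (Fintype.card V - 6) ≤ (Fintype.card V - 1) * deg D v :=
    fun v _ => convex_vertex_five_six (deg D v) (Fintype.card V) (hdeg v) (hcap v)
  have hs := sum_le_sum h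
  rw [sum_add_distrib, sum_const, card_univ, smul_eq_mul, ← mul_sum, sum_deg_eq] at hs
  obtain ⟨s, hs'⟩ : ∃ s, Fintype.card V = s + 14 := ⟨Fintype.card V - 14, by omega⟩
  have hm' : D.edgeFinset.card = 5 * s + 41 := by omega
  rw [hs', hm'] at hs ⊢
  have e1 : s + 14 - 6 = s + 8 := by omega
  have e2 : s + 14 - 1 = s + 13 := by omega
  have e3 : s + 14 - 5 = s + 9 := by omega
  have e4 : 2 * (s + 14) - 22 = 2 * s + 6 := by omega
  rw [e1, e2] at hs
  rw [e3, e4]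
  nlinarith [hs]

/-- **THE SIDES OF A `5`-BIPARTITE `D − z` ON THE CELL `(k, 5, 4)` AT THE GAP `B2`:** `D` is `5`-bipartite, or at
the target (all neighbours of `z` off the side: `6`-bipartite with `k − 7` missing pairs, exactly `2k − 22`), or a
neighbour of `z` lies off the `5`-side and `T + (k − 7) ≤ d(z) (k − 7) + 5`. -/
theorem five_four_sides_B2 (D : SimpleGraph V) [DecidableRel D.Adj] (hk : 14 ≤ Fintype.card V)
    (hm : D.edgeFinset.card + 4 = 5 * (Fintype.card V - 5)) (z : V) (A' : Finset {v : V // v ≠ z})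
    (hA'card : A'.card = 5) (hB : BipSub (del D z) A') (hcap7 : ∀ v, deg D v ≤ (Fintype.card V - 7) + 1) :
    (∃ A : Finset V, A.card = 5 ∧ BipSub D A) ∨
      (∑ v, deg D v * deg D v + 4 * (Fintype.card V - 5) + (2 * Fintype.card V - 22) ≤
        D.edgeFinset.card * Fintype.card V) ∨
      (∑ a : {v : V // v ≠ z}, (if D.Adj a.1 z then deg (del D z) a else 0) + (Fintype.card V - 7) ≤
        deg D z * (Fintype.card V - 7) + 5) := by
  by_cases hall : ∀ a : {v : V // v ≠ z}, D.Adj a.1 z → a ∈ A'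
  · obtain ⟨B, hBcard, hBsub⟩ := bipSub_lift D z A' hB hall
    exact Or.inl ⟨B, by rw [hBcard, hA'card], hBsub⟩
  by_cases hnone : ∀ a : {v : V // v ≠ z}, D.Adj a.1 z → a ∉ A'
  · right; left
    obtain ⟨A, hAcard, hAsub⟩ := bipSub_insert_of_nbhd_off D z A' hB hnone
    rw [hA'card] at hAcard
    have h := sum_deg_sq_le_of_bipSub D A hAsub 6 (Fintype.card V - 7) hAcard (by omega) (by omega)
    have e : Fintype.card V - 1 - (Fintype.card V - 7) = 6 := by omega
    rw [e] at h
    omega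
  · right; right
    push Not at hall
    obtain ⟨w₀, hw₀z, hw₀A⟩ := hall
    obtain ⟨Nz, hNzdef⟩ : ∃ Nz : Finset {v : V // v ≠ z},
        Nz = univ.filter (fun a : {v : V // v ≠ z} => D.Adj a.1 z) := ⟨_, rfl⟩
    have hmemNz : ∀ a : {v : V // v ≠ z}, a ∈ Nz ↔ D.Adj a.1 z := fun a => by
      rw [hNzdef, mem_filter]
      simp only [mem_univ, true_and]
    have hNz : Nz.card = deg D z := by rw [hNzdef]; exact card_nbhd_del D z
    have hTfilt : ∑ a : {v : V // v ≠ z}, (if D.Adj a.1 z then deg (del D z) a else 0) =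
        ∑ a ∈ Nz, deg (del D z) a := by
      rw [hNzdef, sum_filter]
    rw [hTfilt, ← hNz]
    have hdw₀ : deg (del D z) w₀ ≤ 5 := by
      have := deg_le_card_of_bipSub (del D z) A' hB w₀ hw₀A
      rw [hA'card] at this
      exact this
    exact sum_le_of_mem_le_gen Nz (fun a => deg (del D z) a) (Fintype.card V - 7) 5 ((hmemNz w₀).mpr hw₀z)
      (fun a ha => by
        have h := deg_del D z a
        rw [if_pos ((hmemNz a).mp ha)] at h
        have := hcap7 a.1
        omega) hdw₀

/-- `d = 0`: `D − z` on `(k − 1, 6, k − 13)`: `S' + 11 (k − 13) ≤ m (k − 1)`; slack `10 (k − 13)`. -/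
theorem five_four_B2_del_zero (s m' S' T : ℕ) (hm' : m' = 5 * s + 41)
    (hS' : S' + (s + 14 - 13) * 11 ≤ m' * (s + 13)) (hT : T ≤ 0 * (s + 14 - 7)) :
    S' + 2 * T + 0 + 0 * 0 + 4 * (s + 14 - 5) + (2 * (s + 14) - 22) ≤ (m' + 0) * (s + 14) := by
  subst hm'
  have e1 : s + 14 - 13 = s + 1 := by omega
  have e2 : s + 14 - 5 = s + 9 := by omega
  have e3 : 2 * (s + 14) - 22 = 2 * s + 6 := by omega
  rw [e1] at hS'
  rw [e2, e3]
  have hT0 : T = 0 := by omega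
  subst hT0
  nlinarith [hS']

/-- `d = 1`, `D − z` not `5`-bipartite on the diagonal `(k − 1, 5, 0)`: `S' + 10 (k − 12) ≤ m' (k − 1)`, `T ≤ k − 7`;
slack `8 (k − 12)`. -/
theorem five_four_B2_del_one_gap (s m' S' T : ℕ) (hm' : m' = 5 * s + 40)
    (hS' : S' + 2 * 5 * (s + 13 - 2 * 5 - 1) ≤ m' * (s + 13)) (hT : T ≤ 1 * (s + 14 - 7)) :
    S' + 2 * T + 1 + 1 * 1 + 4 * (s + 14 - 5) + (2 * (s + 14) - 22) ≤ (m' + 1) * (s + 14) := by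
  subst hm'
  have e1 : s + 13 - 2 * 5 - 1 = s + 2 := by omega
  have e2 : s + 14 - 5 = s + 9 := by omega
  have e3 : 2 * (s + 14) - 22 = 2 * s + 6 := by omega
  have e4 : s + 14 - 7 = s + 7 := by omega
  rw [e1] at hS'
  rw [e4] at hT
  rw [e2, e3]
  nlinarith [hS', hT]

/-- `d = 1`, the envelope read (`D − z` `5`-bipartite, the neighbour off the side): `S' ≤ m' (k − 1)`,
`T + (k − 7) ≤ (k − 7) + 5` — EXACTLY the target: `K_{5,k−6}` plus a pendant vertex at the large side is the family
`B2`, `K_{6,k−6}` minus a `(k − 7)`-star. -/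
theorem five_four_B2_del_one_env (s m' S' T : ℕ) (hm' : m' = 5 * s + 40)
    (hS' : S' ≤ m' * (s + 13)) (hT : T + (s + 14 - 7) ≤ 1 * (s + 14 - 7) + 5) :
    S' + 2 * T + 1 + 1 * 1 + 4 * (s + 14 - 5) + (2 * (s + 14) - 22) ≤ (m' + 1) * (s + 14) := by
  subst hm'
  have e2 : s + 14 - 5 = s + 9 := by omega
  have e3 : 2 * (s + 14) - 22 = 2 * s + 6 := by omega
  have e4 : s + 14 - 7 = s + 7 := by omega
  rw [e4] at hT
  rw [e2, e3]
  nlinarith [hS', hT]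

/-- `d = 2`, mixed onto `(k − 1, 5, 1)`: `S' + (k − 3) ≤ m' (k − 1)`, `T + (k − 7) ≤ 2 (k − 7) + 5`; slack `6`. -/
theorem five_four_B2_del_two_mixed (s m' S' T : ℕ) (hm' : m' = 5 * s + 39)
    (hS' : S' + 1 * (s + 13 - 1 - 1) ≤ m' * (s + 13)) (hT : T + (s + 14 - 7) ≤ 2 * (s + 14 - 7) + 5) :
    S' + 2 * T + 2 + 2 * 2 + 4 * (s + 14 - 5) + (2 * (s + 14) - 22) ≤ (m' + 2) * (s + 14) := by
  subst hm'
  have e1 : s + 13 - 1 - 1 = s + 11 := by omega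
  have e2 : s + 14 - 5 = s + 9 := by omega
  have e3 : 2 * (s + 14) - 22 = 2 * s + 6 := by omega
  have e4 : s + 14 - 7 = s + 7 := by omega
  rw [e1] at hS'
  rw [e4] at hT
  rw [e2, e3]
  nlinarith [hS', hT]

/-- `d = 2`, `D − z` not `5`-bipartite on `(k − 1, 5, 1)`: `S' + (k − 3) + 8 (k − 12) ≤ m' (k − 1)`, `T ≤ 2 (k − 7)`;
slack `6 (k − 11)`. -/
theorem five_four_B2_del_two_gap (s m' S' T : ℕ) (hm' : m' = 5 * s + 39)
    (hS' : S' + (s + 13 - 2) + 2 * (s + 13 - 2 * 5 - 1) * (5 - 1) ≤ m' * (s + 13)) (hT : T ≤ 2 * (s + 14 - 7)) :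
    S' + 2 * T + 2 + 2 * 2 + 4 * (s + 14 - 5) + (2 * (s + 14) - 22) ≤ (m' + 2) * (s + 14) := by
  subst hm'
  have e0 : s + 13 - 2 = s + 11 := by omega
  have e1 : s + 13 - 2 * 5 - 1 = s + 2 := by omega
  have e2 : s + 14 - 5 = s + 9 := by omega
  have e3 : 2 * (s + 14) - 22 = 2 * s + 6 := by omega
  have e4 : s + 14 - 7 = s + 7 := by omega
  rw [e0, e1] at hS'
  rw [e4] at hT
  rw [e2, e3]
  nlinarith [hS', hT]

/-- `d = 3`, mixed onto `(k − 1, 5, 2)`: `S' + 2 (k − 4) ≤ m' (k − 1)`, `T + (k − 7) ≤ 3 (k − 7) + 5`; slack `8`. -/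
theorem five_four_B2_del_three_mixed (s m' S' T : ℕ) (hm' : m' = 5 * s + 38)
    (hS' : S' + 2 * (s + 13 - 1 - 2) ≤ m' * (s + 13)) (hT : T + (s + 14 - 7) ≤ 3 * (s + 14 - 7) + 5) :
    S' + 2 * T + 3 + 3 * 3 + 4 * (s + 14 - 5) + (2 * (s + 14) - 22) ≤ (m' + 3) * (s + 14) := by
  subst hm'
  have e1 : s + 13 - 1 - 2 = s + 10 := by omega
  have e2 : s + 14 - 5 = s + 9 := by omega
  have e3 : 2 * (s + 14) - 22 = 2 * s + 6 := by omega
  have e4 : s + 14 - 7 = s + 7 := by omega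
  rw [e1] at hS'
  rw [e4] at hT
  rw [e2, e3]
  nlinarith [hS', hT]

/-- `d = 3`, `D − z` not `5`-bipartite on `(k − 1, 5, 2)`: `S' + 2 (k − 4) + 6 (k − 12) ≤ m' (k − 1)`,
`T ≤ 3 (k − 7)`; slack `4 (k − 10)`. -/
theorem five_four_B2_del_three_gap (s m' S' T : ℕ) (hm' : m' = 5 * s + 38)
    (hS' : S' + 2 * (s + 13 - 1 - 2) + 2 * (s + 13 - 2 * 5 - 1) * (5 - 2) ≤ m' * (s + 13))
    (hT : T ≤ 3 * (s + 14 - 7)) :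
    S' + 2 * T + 3 + 3 * 3 + 4 * (s + 14 - 5) + (2 * (s + 14) - 22) ≤ (m' + 3) * (s + 14) := by
  subst hm'
  have e0 : s + 13 - 1 - 2 = s + 10 := by omega
  have e1 : s + 13 - 2 * 5 - 1 = s + 2 := by omega
  have e2 : s + 14 - 5 = s + 9 := by omega
  have e3 : 2 * (s + 14) - 22 = 2 * s + 6 := by omega
  have e4 : s + 14 - 7 = s + 7 := by omega
  rw [e0, e1] at hS'
  rw [e4] at hT
  rw [e2, e3]
  nlinarith [hS', hT]

/-- `d = 4`, mixed onto `(k − 1, 5, 3)`: `S' + 3 (k − 5) ≤ m' (k − 1)`, `T + (k − 7) ≤ 4 (k − 7) + 5`; slack `6`. -/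
theorem five_four_B2_del_four_mixed (s m' S' T : ℕ) (hm' : m' = 5 * s + 37)
    (hS' : S' + 3 * (s + 13 - 1 - 3) ≤ m' * (s + 13)) (hT : T + (s + 14 - 7) ≤ 4 * (s + 14 - 7) + 5) :
    S' + 2 * T + 4 + 4 * 4 + 4 * (s + 14 - 5) + (2 * (s + 14) - 22) ≤ (m' + 4) * (s + 14) := by
  subst hm'
  have e1 : s + 13 - 1 - 3 = s + 9 := by omega
  have e2 : s + 14 - 5 = s + 9 := by omega
  have e3 : 2 * (s + 14) - 22 = 2 * s + 6 := by omega
  have e4 : s + 14 - 7 = s + 7 := by omega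
  rw [e1] at hS'
  rw [e4] at hT
  rw [e2, e3]
  nlinarith [hS', hT]

/-- `d = 4`, `D − z` not `5`-bipartite on `(k − 1, 5, 3)` at its sharp gap `T = 2 (k − 1) − 22`:
`S' + 3 (k − 5) + (2k − 24) ≤ m' (k − 1)`, `T ≤ 4 (k − 7)`; slack `6` (the neighbours of `z` are at most `k − 7`
because `D` has no vertex at the cap). -/
theorem five_four_B2_del_four_gap (s m' S' T : ℕ) (hm' : m' = 5 * s + 37)
    (hS' : S' + 3 * (s + 13 - 4) + (2 * (s + 13) - 22) ≤ m' * (s + 13)) (hT : T ≤ 4 * (s + 14 - 7)) :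
    S' + 2 * T + 4 + 4 * 4 + 4 * (s + 14 - 5) + (2 * (s + 14) - 22) ≤ (m' + 4) * (s + 14) := by
  subst hm'
  have e0 : s + 13 - 4 = s + 9 := by omega
  have e1 : 2 * (s + 13) - 22 = 2 * s + 4 := by omega
  have e2 : s + 14 - 5 = s + 9 := by omega
  have e3 : 2 * (s + 14) - 22 = 2 * s + 6 := by omega
  have e4 : s + 14 - 7 = s + 7 := by omega
  rw [e0, e1] at hS'
  rw [e4] at hT
  rw [e2, e3]
  nlinarith [hS', hT]

end C047

end TriangleCap

end PercRepro
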